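import Summits.NavierStokesRegularity.FluidComputer.PalasekTowerStageLocalEnergy
import Literature.Analysis.FluidPDE.CalderonSplittingLp

/-!
# No energy teleportation (II): local energies of a bounded classical Clay flow are Lipschitz in time
# uniformly in the centre, hence the speed decays at spatial infinity UNIFORMLY on the slab

Cell `ns-blowup`, seat `ns-blowup-fc-prover-3` (g2; prover; D-0074 GROUP C/E «BRIDGE SUPPORT»;
bears_on LADDER-NS N1, route `PalasekTowerBreakdown`, items stmt-NavierStokesRegularity-19249 /
19250 / 19178 — supports only, nothing claimed). Sequel of `PalasekTowerStageLocalEnergy.lean`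
(this seat, p440128: the flux bound at one time, `LocalEnergy.abs_flux_le`). LABEL: E–C typing
(KERNEL analysis; every statement PROVED; no `Prop` introduced; the only Literature facts used are
PROVED theorems: Tao's a.e. pressure normalisation `tao2011_forced_pressure_normalisation_ae_holds`,
the Clay-force slice bounds `clayForce_slice_sup_integrable` / `clayForce_slice_potential_bounds`,
the local energy identity `IsClassicalNSSolutionOn.hasDerivAt_integral_cutoff_norm_sq`).
WHAT THIS IS NOT: not Navier–Stokes evidence — a-priori statements about EVERY classical
finite-energy solution with bounded velocity, bounded velocity gradient and a Clay-class force;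
nothing is constructed.

## What is proved

* §4 `LocalEnergy.localEnergy_lipschitz_uniform` — **no energy teleportation**: for `(u, p)`
  classical on `[0, T] × ℝ³` (`ν > 0`), Clay force, `∫|u(t)|² ≤ C`, `‖u‖ ≤ M`, `‖Du‖ ≤ B`, and a test
  function `φ ∈ C_c^∞`, ONE constant `K` gives
  `|∫ φ(x + a)|u(t, x)|² − ∫ φ(x + a)|u(t', x)|²| ≤ K |t − t'|` for EVERY centre `a` and all
  `t, t' ∈ [0, T]` (the derivative on `(0, T)` is the local energy flux; at a.e. time the pressure is
  normalised and `abs_flux_le` bounds it by `K`, a continuous function bounded a.e. is bounded;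
  Lagrange's mean value theorem).
* §5 `LocalEnergy.exists_radius_norm_lt` — **uniform spatial decay on the slab**: under the same
  hypotheses, for every `L > 0` there is `ρ` with `‖u(t, x)‖ < L` for ALL `t ∈ [0, T]`, `‖x‖ ≥ ρ`.
  (Speed `≥ L` at `(tₙ, xₙ)`, `‖xₙ‖ → ∞`, puts energy `≥ δ = (L/2)²|B̄_r|`, `r = L/(2(B+1))`, in
  `B̄(xₙ, r)` at time `tₙ`; along a subsequence `tₙ → t⋆` and by §4 the energy of the single slice
  `u(t⋆)` in `B(xₙ, 2r)` stays `> δ/2` — impossible for balls escaping to infinity under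
  `∫|u(t⋆)|² < ∞`, tree `CalderonSplittingLp.tendsto_setLIntegral_ball_cocompact'`.)

The registered-stage form (every `Stage`, `ν > 0`: `M = c₂Y_k`, `B` from
`Stage.exists_norm_fderiv_le`) and the resulting UNCONDITIONAL first hitting at every hand-over are
in `PalasekTowerStageTightness.lean` (this seat).

References: L. Caffarelli, R. Kohn, L. Nirenberg, CPAM 35 (1982) §2 (2.5)
[cite: CaffarelliKohnNirenberg1982, §2 (2.5)]; T. Tao, Anal. PDE 6 (2013), Lemma 4.1 (i)
[cite: Tao2011, Lemma 4.1 (i)]; C. L. Fefferman, Clay problem description, (5) (7)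
[cite: FeffermanClay2006, (5)].
-/

noncomputable section

namespace Summit.NavierStokesRegularity.FluidComputer.PalasekTowerClayBridge

open Set MeasureTheory Filter Topology Function Real
open scoped ENNReal ContDiff NNReal InnerProductSpace RealInnerProductSpace
open Laplacian
open Literature.Analysis.FluidPDE

namespace LocalEnergy

/-! ## §4 Local energies are Lipschitz in time, uniformly in the centre -/

/-- **No energy teleportation.** For a classical solution of the forced system on `[0, T] × ℝ³`
(`ν > 0`, `T > 0`) with Clay-class force, finite energy, `‖u‖ ≤ M` and `‖Du‖ ≤ B` on the slab, and
a test function `φ`, there is ONE constant `K` with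
`|∫ φ(x + a)|u(t,x)|² − ∫ φ(x + a)|u(t',x)|²| ≤ K |t − t'|` for EVERY centre `a` and all
`t, t' ∈ [0, T]`. [cite: CaffarelliKohnNirenberg1982, §2 (2.5)] [cite: Tao2011, Lemma 4.1 (i)] -/
theorem localEnergy_lipschitz_uniform {ν T : ℝ} (hν : 0 < ν) (hT : 0 < T)
    {f u : ℝ → EuclideanSpace ℝ (Fin 3) → EuclideanSpace ℝ (Fin 3)}
    {p : ℝ → EuclideanSpace ℝ (Fin 3) → ℝ}
    (hsol : IsClassicalNSSolutionOn (Icc 0 T) ν f u p)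
    (hfs : IsSmoothOnHalfSpace f) (hfd : HasRapidSpaceTimeDecay f)
    {M B : ℝ} (hM : ∀ t ∈ Icc 0 T, ∀ x, ‖u t x‖ ≤ M)
    (hB : ∀ t ∈ Icc 0 T, ∀ x, ‖fderiv ℝ (u t) x‖ ≤ B)
    (hE : ∃ C : ℝ≥0, ∀ t ∈ Icc 0 T, ∫⁻ x, ‖u t x‖ₑ ^ 2 ≤ C)
    {φ : EuclideanSpace ℝ (Fin 3) → ℝ} (hφ : ContDiff ℝ ∞ φ) (hφc : HasCompactSupport φ) :
    ∃ K : ℝ, ∀ a : EuclideanSpace ℝ (Fin 3), ∀ t ∈ Icc 0 T, ∀ t' ∈ Icc 0 T,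
      |(∫ x, φ (x + a) * ‖u t x‖ ^ 2) - ∫ x, φ (x + a) * ‖u t' x‖ ^ 2| ≤ K * |t - t'| := by
  obtain ⟨C, hC⟩ := hE
  -- energy in real form
  have hUE : ∀ t ∈ Icc 0 T, Integrable (fun x => ‖u t x‖ ^ 2) ∧ ∫ x, ‖u t x‖ ^ 2 ≤ (C : ℝ) := by
    intro t ht
    have h := integrable_sq_of_lintegral_le (μ := volume)
      (hsol.contDiff_velocity ht).continuous.aestronglyMeasurable ENNReal.coe_ne_top (hC t ht)
    rwa [ENNReal.coe_toReal] at h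
  -- the force: sup bound and potential bound
  obtain ⟨Mf, N, -, hMN⟩ := clayForce_slice_sup_integrable (T := T) hfs hfd
  obtain ⟨Cf, Pf, hCft, hPft, hb⟩ := clayForce_slice_potential_bounds (T := T) hfs hfd
  have hΦ : ∀ t ∈ Icc 0 T, AEStronglyMeasurable (forcePotential (f t)) volume ∧
      Integrable (fun x => forcePotential (f t) x ^ 2) ∧
      ∫ x, forcePotential (f t) x ^ 2 ≤ Pf.toReal := by
    intro t ht
    obtain ⟨-, hm, hle⟩ := hb t ht
    obtain ⟨hi, hI⟩ := integrable_sq_of_lintegral_le (μ := volume) hm hPft.ne hle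
    simp only [Real.norm_eq_abs, sq_abs] at hi hI
    exact ⟨hm, hi, hI⟩
  -- the a.e. pressure normalisation
  have hf' : IsSmoothSpaceTimeOn (Icc 0 T) f := hfs.isSmoothSpaceTimeOn_Icc T
  have hfE : ∫⁻ t in Icc 0 T, (∫⁻ x, ‖f t x‖ₑ ^ 2) ^ (1 / 2 : ℝ) < ⊤ := by
    calc ∫⁻ t in Icc 0 T, (∫⁻ x, ‖f t x‖ₑ ^ 2) ^ (1 / 2 : ℝ)
        ≤ ∫⁻ _t in Icc 0 T, Cf ^ (1 / 2 : ℝ) :=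
          setLIntegral_mono' measurableSet_Icc fun t ht =>
            ENNReal.rpow_le_rpow (hb t ht).1 (by norm_num)
      _ = Cf ^ (1 / 2 : ℝ) * volume (Icc (0 : ℝ) T) := setLIntegral_const _ _
      _ < ⊤ := ENNReal.mul_lt_top (ENNReal.rpow_lt_top_of_nonneg (by norm_num) hCft.ne)
          (by rw [Real.volume_Icc]; exact ENNReal.ofReal_lt_top)
  obtain ⟨Cn, -, hae⟩ := tao2011_forced_pressure_normalisation_ae_holds hν hT hsol hf' hfE ⟨C, hC⟩
  have hae' : ∀ᵐ t ∂volume, t ∈ Icc 0 T → ∀ x,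
      p t x = normalisedPressure (u t) x + forcePotential (f t) x + Cn t :=
    (ae_restrict_iff' measurableSet_Icc).1 hae
  -- the constants of the test function
  have hφ2 : ContDiff ℝ 2 φ := hφ.of_le (by norm_cast)
  set IΔ : ℝ := ∫ x, |(Δ φ) x| with hIΔ
  set ID : ℝ := ∫ x, ‖fderiv ℝ φ x‖ with hID
  set D2 : ℝ := ∫ x, ‖fderiv ℝ φ x‖ ^ 2 with hD2
  set Iφ : ℝ := ∫ x, |φ x| with hIφ
  set K : ℝ := ν * M ^ 2 * IΔ + M ^ 3 * ID +
    ((27 * regLaplacianMass) ^ 2 * (M ^ 2 * (C : ℝ)) + Pf.toReal + 2 * (M ^ 2 * D2)) +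
    2 * Mf * M * Iφ + 6 * ν * B ^ 2 * Iφ with hK
  refine ⟨K, fun a => ?_⟩
  -- the translated cut-off and its (translation-invariant) constants
  set ψ : EuclideanSpace ℝ (Fin 3) → ℝ := fun x => φ (x + a) with hψ
  have hψs : ContDiff ℝ ∞ ψ := contDiff_translate hφ a
  have hψc : HasCompactSupport ψ := hasCompactSupport_translate hφc a
  have eΔ : ∫ x, |(Δ ψ) x| = IΔ := by
    have h := integral_translate (fun y => |(Δ φ) y|) a
    rw [hIΔ, ← h]
    refine integral_congr_ae (Eventually.of_forall fun x => ?_)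
    show |(Δ ψ) x| = |(Δ φ) (x + a)|
    rw [hψ, laplacian_translate]
  have eD : ∫ x, ‖fderiv ℝ ψ x‖ = ID := by
    have h := integral_translate (fun y => ‖fderiv ℝ φ y‖) a
    rw [hID, ← h]
    refine integral_congr_ae (Eventually.of_forall fun x => ?_)
    show ‖fderiv ℝ ψ x‖ = ‖fderiv ℝ φ (x + a)‖
    rw [hψ, fderiv_translate]
  have eD2 : ∫ x, ‖fderiv ℝ ψ x‖ ^ 2 = D2 := by
    have h := integral_translate (fun y => ‖fderiv ℝ φ y‖ ^ 2) a
    rw [hD2, ← h]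
    refine integral_congr_ae (Eventually.of_forall fun x => ?_)
    show ‖fderiv ℝ ψ x‖ ^ 2 = ‖fderiv ℝ φ (x + a)‖ ^ 2
    rw [hψ, fderiv_translate]
  have eφ : ∫ x, |ψ x| = Iφ := by
    have h := integral_translate (fun y => |φ y|) a
    rw [hIφ, ← h]
  -- the solution on the open slab, the local energy and its derivative
  have hsolo : IsClassicalNSSolutionOn (Ioo 0 T) ν f u p :=
    hsol.mono Ioo_subset_Icc_self (uniqueDiffOn_Ioo 0 T)
  set G : ℝ → ℝ := fun t => ∫ x, ψ x * ‖u t x‖ ^ 2 with hG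
  set Df : ℝ → ℝ := fun t => ∫ x, ψ x * (2 * ⟪u t x, timeDerivWithin (Ioo 0 T) u t x⟫) with hDf
  have hderiv : ∀ t ∈ Ioo 0 T, HasDerivAt G (Df t) t := fun t ht =>
    hsolo.hasDerivAt_integral_cutoff_norm_sq isOpen_Ioo hψs hψc ht
  have hDcont : ContinuousOn Df (Ioo 0 T) :=
    hsolo.continuousOn_integral_cutoff_inner_timeDeriv isOpen_Ioo hψs.continuous hψc
  have hGcont : ContinuousOn G (Icc 0 T) := by
    refine continuousOn_integral_of_support_subset (μ := volume) (K := tsupport ψ) hψc ?_ ?_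
    · have h1 : ContinuousOn (fun z : ℝ × EuclideanSpace ℝ (Fin 3) => ψ z.2) (Icc 0 T ×ˢ univ) :=
        (hψs.continuous.comp continuous_snd).continuousOn
      exact h1.mul ((hsol.smooth_velocity.continuousOn.norm).pow 2)
    · intro t _ x hx
      show ψ x * ‖u t x‖ ^ 2 = 0
      rw [image_eq_zero_of_notMem_tsupport hx, zero_mul]
  -- the derivative is bounded by `K` at almost every, hence every, interior time
  have hbound : ∀ t ∈ Ioo 0 T, (∀ x, p t x = normalisedPressure (u t) x + forcePotential (f t) x + Cn t) →
      |Df t| ≤ K := by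
    intro t ht hPn
    have ht' : t ∈ Icc 0 T := Ioo_subset_Icc_self ht
    obtain ⟨hUi, hUE'⟩ := hUE t ht'
    obtain ⟨hΦm, hΦi, hΦE⟩ := hΦ t ht'
    have hD : Continuous (timeDerivWithin (Ioo 0 T) u t) :=
      ((hsolo.smooth_velocity.timeDerivWithin isOpen_Ioo.uniqueDiffOn).contDiff_slice ht).continuous
    have h := abs_flux_le hν.le (hsol.contDiff_velocity ht')
      ((hsol.contDiff_pressure ht').of_le (by norm_cast)) hD ((hf'.contDiff_slice ht').continuous)
      (hsolo.momentum t ht) (hsol.divFree t ht') (hM t ht') (hB t ht') (hMN t ht').1 hUi hUE'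
      hPn hΦm hΦi hΦE hψs hψc
    rw [eΔ, eD, eD2, eφ] at h
    rw [hK]
    exact h
  have hall : ∀ t ∈ Ioo 0 T, |Df t| ≤ K := by
    refine forall_abs_le_of_ae isOpen_Ioo hDcont ?_
    filter_upwards [hae'] with t ht htI
    exact hbound t htI (ht (Ioo_subset_Icc_self htI))
  -- mean value theorem
  have hmvt : ∀ s₁ ∈ Icc 0 T, ∀ s₂ ∈ Icc 0 T, s₁ < s₂ → |G s₂ - G s₁| ≤ K * (s₂ - s₁) := by
    intro s₁ hs₁ s₂ hs₂ hlt
    obtain ⟨ξ, hξ, hslope⟩ := exists_hasDerivAt_eq_slope G Df hlt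
      (hGcont.mono (Icc_subset_Icc hs₁.1 hs₂.2))
      (fun x hx => hderiv x ⟨lt_of_le_of_lt hs₁.1 hx.1, lt_of_lt_of_le hx.2 hs₂.2⟩)
    have hξI : ξ ∈ Ioo 0 T := ⟨lt_of_le_of_lt hs₁.1 hξ.1, lt_of_lt_of_le hξ.2 hs₂.2⟩
    have hne : s₂ - s₁ ≠ 0 := sub_ne_zero.2 hlt.ne'
    have e : G s₂ - G s₁ = Df ξ * (s₂ - s₁) := by
      rw [hslope, div_mul_cancel₀ _ hne]
    rw [e, abs_mul, abs_of_pos (sub_pos.2 hlt)]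
    exact mul_le_mul_of_nonneg_right (hall ξ hξI) (sub_pos.2 hlt).le
  intro t ht t' ht'
  show |G t - G t'| ≤ K * |t - t'|
  rcases lt_trichotomy t t' with hlt | heq | hgt
  · rw [abs_sub_comm, abs_sub_comm t t', abs_of_pos (sub_pos.2 hlt)]
    exact hmvt t ht t' ht' hlt
  · subst heq; simp
  · rw [abs_of_pos (sub_pos.2 hgt)]
    exact hmvt t' ht' t ht hgt


/-! ## §5 Uniform spatial decay on the slab (tightness of the speed) -/

/-- **Uniform spatial decay of the speed on the slab.** For a classical solution of the forced
system on `[0, T] × ℝ³` (`ν > 0`, `T > 0`) with a Clay-class force, finite energy, `‖u‖ ≤ M` and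
`‖Du‖ ≤ B` on the slab: for every level `L > 0` there is a radius `ρ` such that `‖u(t, x)‖ < L` for ALL
`t ∈ [0, T]` and all `‖x‖ ≥ ρ` — the super-level sets `{‖u‖ ≥ L}` of the whole slab lie in one ball.
Proof: speed `≥ L` at `(tₙ, xₙ)` with `‖xₙ‖ → ∞` puts energy `≥ δ = (L/2)²·|B_r|` in the ball
`B(xₙ, r)`, `r = L/(2(B+1))` (spatial Lipschitz bound); along a subsequence `tₙ → t⋆`, and by the
uniform time-Lipschitz bound of local energies (`localEnergy_lipschitz_uniform`) the energy of the slice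
`u(t⋆)` in `B(xₙ, 2r)` stays `≥ δ/2` for large `n` — impossible, since these balls escape to infinity
and `∫|u(t⋆)|² < ∞` (`tendsto_setLIntegral_ball_cocompact'`). [folklore] -/
theorem exists_radius_norm_lt {ν T : ℝ} (hν : 0 < ν) (hT : 0 < T)
    {f u : ℝ → EuclideanSpace ℝ (Fin 3) → EuclideanSpace ℝ (Fin 3)}
    {p : ℝ → EuclideanSpace ℝ (Fin 3) → ℝ}
    (hsol : IsClassicalNSSolutionOn (Icc 0 T) ν f u p)
    (hfs : IsSmoothOnHalfSpace f) (hfd : HasRapidSpaceTimeDecay f)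
    {M B : ℝ} (hM : ∀ t ∈ Icc 0 T, ∀ x, ‖u t x‖ ≤ M)
    (hB : ∀ t ∈ Icc 0 T, ∀ x, ‖fderiv ℝ (u t) x‖ ≤ B)
    (hE : ∃ C : ℝ≥0, ∀ t ∈ Icc 0 T, ∫⁻ x, ‖u t x‖ₑ ^ 2 ≤ C)
    {L : ℝ} (hL : 0 < L) :
    ∃ ρ : ℝ, ∀ t ∈ Icc 0 T, ∀ x : EuclideanSpace ℝ (Fin 3), ρ ≤ ‖x‖ → ‖u t x‖ < L := by
  by_contra H
  push Not at H
  choose tn htn xn hxn hLn using fun n : ℕ => H n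
  -- energy in real form
  have hUE : ∀ t ∈ Icc 0 T, Integrable (fun x => ‖u t x‖ ^ 2) := by
    obtain ⟨C, hC⟩ := hE
    intro t ht
    exact (integrable_sq_of_lintegral_le (μ := volume)
      (hsol.contDiff_velocity ht).continuous.aestronglyMeasurable ENNReal.coe_ne_top (hC t ht)).1
  have hEfin : ∀ t ∈ Icc 0 T, ∫⁻ x, ‖u t x‖ₑ ^ 2 ≠ ⊤ := by
    obtain ⟨C, hC⟩ := hE
    exact fun t ht => (lt_of_le_of_lt (hC t ht) ENNReal.coe_lt_top).ne
  -- spatial Lipschitz bound and the radius `r`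
  have hB0 : 0 ≤ B := (norm_nonneg _).trans (hB 0 ⟨le_rfl, hT.le⟩ 0)
  have hlip : ∀ t ∈ Icc 0 T, ∀ x y, ‖u t x - u t y‖ ≤ B * ‖x - y‖ := fun t ht x y =>
    Convex.norm_image_sub_le_of_norm_fderiv_le
      (fun z _ => ((hsol.contDiff_velocity ht).differentiable (by simp)).differentiableAt)
      (fun z _ => hB t ht z) convex_univ (mem_univ y) (mem_univ x)
  set r : ℝ := L / (2 * (B + 1)) with hr
  have hr0 : 0 < r := by rw [hr]; positivity
  have hBr : B * r ≤ L / 2 := by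
    rw [hr, mul_div_assoc', div_le_div_iff₀ (by positivity) (by positivity)]
    nlinarith
  have hhalf : ∀ n, ∀ y ∈ Metric.closedBall (xn n) r, L / 2 ≤ ‖u (tn n) y‖ := by
    intro n y hy
    have h1 := hlip (tn n) (htn n) (xn n) y
    have h2 : ‖xn n - y‖ ≤ r := by rw [← dist_eq_norm, dist_comm]; exact hy
    have h3 := norm_sub_norm_le (u (tn n) (xn n)) (u (tn n) y)
    nlinarith [hLn n, mul_le_mul_of_nonneg_left h2 hB0]
  -- the bump: `= 1` on `B̄(0, r)`, supported in `B(0, 2r)`, values in `[0, 1]`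
  let bump : ContDiffBump (0 : EuclideanSpace ℝ (Fin 3)) := ⟨r, 2 * r, hr0, by linarith⟩
  set φ : EuclideanSpace ℝ (Fin 3) → ℝ := ⇑bump with hφ
  have hφs : ContDiff ℝ ∞ φ := bump.contDiff
  have hφc : HasCompactSupport φ := bump.hasCompactSupport
  have hφ1 : ∀ y ∈ Metric.closedBall (0 : EuclideanSpace ℝ (Fin 3)) r, φ y = 1 := fun y hy =>
    bump.one_of_mem_closedBall hy
  have hφnn : ∀ y, 0 ≤ φ y := fun y => bump.nonneg
  have hφle : ∀ y, φ y ≤ 1 := fun y => bump.le_one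
  have hφsupp : ∀ y, φ y ≠ 0 → y ∈ Metric.ball (0 : EuclideanSpace ℝ (Fin 3)) (2 * r) := by
    intro y hy
    have h : y ∈ Function.support φ := hy
    rwa [hφ, bump.support_eq] at h
  -- the uniform time-Lipschitz constant of the local energies
  obtain ⟨K, hK⟩ := localEnergy_lipschitz_uniform hν hT hsol hfs hfd hM hB hE hφs hφc
  set K' : ℝ := |K| + 1 with hK'
  have hK'0 : 0 < K' := by rw [hK']; positivity
  -- the energy quantum `δ`
  set V : ℝ := (volume (Metric.closedBall (0 : EuclideanSpace ℝ (Fin 3)) r)).toReal with hV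
  have hVpos : 0 < V :=
    ENNReal.toReal_pos (Metric.measure_closedBall_pos volume _ hr0).ne' measure_closedBall_lt_top.ne
  set δ : ℝ := (L / 2) ^ 2 * V with hδ
  have hδ0 : 0 < δ := by rw [hδ]; positivity
  -- local energy `≥ δ` around `xn n` at time `tn n`
  have hlow : ∀ n, δ ≤ ∫ x, φ (x + -xn n) * ‖u (tn n) x‖ ^ 2 := by
    intro n
    have hvol : (volume (Metric.closedBall (xn n) r)).toReal = V := by
      rw [hV, Measure.addHaar_closedBall_center]
    have hind : ∫ x, (Metric.closedBall (xn n) r).indicator (fun _ => (L / 2) ^ 2) x = δ := by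
      rw [integral_indicator Metric.isClosed_closedBall.measurableSet, setIntegral_const, smul_eq_mul,
        measureReal_def, hvol, hδ, mul_comm]
    rw [← hind]
    refine integral_mono ?_ ?_ fun x => ?_
    · exact (integrableOn_const measure_closedBall_lt_top.ne).integrable_indicator
        Metric.isClosed_closedBall.measurableSet
    · exact ((contDiff_translate hφs _).continuous.mul
        ((hsol.contDiff_velocity (htn n)).continuous.norm.pow 2)).integrable_of_hasCompactSupport
        ((hasCompactSupport_translate hφc _).mul_right)
    · by_cases hx : x ∈ Metric.closedBall (xn n) r
      · rw [indicator_of_mem hx]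
        have hx' : x + -xn n ∈ Metric.closedBall (0 : EuclideanSpace ℝ (Fin 3)) r := by
          rw [Metric.mem_closedBall, dist_zero_right, ← sub_eq_add_neg, ← dist_eq_norm]
          exact hx
        rw [hφ1 _ hx', one_mul]
        exact pow_le_pow_left₀ (by positivity) (hhalf n x hx) 2
      · rw [indicator_of_notMem hx]
        exact mul_nonneg (hφnn _) (sq_nonneg _)
  -- a convergent subsequence of times; the centres escape to infinity along it
  obtain ⟨tinf, htinf, σ, hσ, hlim⟩ := isCompact_Icc.tendsto_subseq htn
  have hesc : Tendsto (fun n => xn (σ n)) atTop (cocompact (EuclideanSpace ℝ (Fin 3))) := by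
    rw [← Metric.cobounded_eq_cocompact]
    refine tendsto_norm_atTop_iff_cobounded.1 ?_
    refine tendsto_atTop_mono (fun n => ?_) tendsto_natCast_atTop_atTop
    exact (Nat.cast_le.2 (hσ.id_le n)).trans (hxn (σ n))
  have htail : Tendsto (fun n => ∫⁻ x in Metric.ball (xn (σ n)) (2 * r), ‖u tinf x‖ₑ ^ 2)
      atTop (𝓝 0) :=
    (CalderonSplittingLp.tendsto_setLIntegral_ball_cocompact' (hEfin tinf htinf) (2 * r)).comp hesc
  -- choose `n`: time close to `tinf`, tail energy small
  have hev1 : ∀ᶠ n in atTop, |tn (σ n) - tinf| < δ / (2 * K') := by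
    have h := Metric.tendsto_nhds.1 hlim (δ / (2 * K')) (by positivity)
    filter_upwards [h] with n hn
    rwa [Real.dist_eq] at hn
  have hev2 : ∀ᶠ n in atTop,
      ∫⁻ x in Metric.ball (xn (σ n)) (2 * r), ‖u tinf x‖ₑ ^ 2 < ENNReal.ofReal (δ / 2) :=
    htail (Iio_mem_nhds (ENNReal.ofReal_pos.2 (by positivity)))
  obtain ⟨n, hn1, hn2⟩ := (hev1.and hev2).exists
  -- the local energy around `xn (σ n)` at time `tinf` is `< δ/2` …
  set a : EuclideanSpace ℝ (Fin 3) := -xn (σ n) with ha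
  have hup : ∫ x, φ (x + a) * ‖u tinf x‖ ^ 2 < δ / 2 := by
    have hle : ∫ x, φ (x + a) * ‖u tinf x‖ ^ 2 ≤
        ∫ x, (Metric.ball (xn (σ n)) (2 * r)).indicator (fun y => ‖u tinf y‖ ^ 2) x := by
      refine integral_mono ?_ ((hUE tinf htinf).indicator measurableSet_ball) fun x => ?_
      · exact ((contDiff_translate hφs _).continuous.mul
          ((hsol.contDiff_velocity htinf).continuous.norm.pow 2)).integrable_of_hasCompactSupport
          ((hasCompactSupport_translate hφc _).mul_right)
      · by_cases hx : x ∈ Metric.ball (xn (σ n)) (2 * r)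
        · rw [indicator_of_mem hx]
          exact mul_le_of_le_one_left (sq_nonneg _) (hφle _)
        · have h0 : φ (x + a) = 0 := by
            by_contra hne
            have h := hφsupp _ hne
            rw [Metric.mem_ball, dist_zero_right, ha, ← sub_eq_add_neg, ← dist_eq_norm] at h
            exact hx h
          rw [indicator_of_notMem hx, h0, zero_mul]
    have heq : ∫ x, (Metric.ball (xn (σ n)) (2 * r)).indicator (fun y => ‖u tinf y‖ ^ 2) x =
        (∫⁻ x in Metric.ball (xn (σ n)) (2 * r), ‖u tinf x‖ₑ ^ 2).toReal := by
      rw [integral_indicator measurableSet_ball,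
        integral_eq_lintegral_of_nonneg_ae (Eventually.of_forall fun x => sq_nonneg _)
          (hUE tinf htinf).aestronglyMeasurable.restrict]
      congr 1
      refine lintegral_congr fun x => ?_
      rw [← ofReal_norm, ENNReal.ofReal_pow (norm_nonneg _)]
    have hlt : (∫⁻ x in Metric.ball (xn (σ n)) (2 * r), ‖u tinf x‖ₑ ^ 2).toReal < δ / 2 :=
      ENNReal.toReal_lt_of_lt_ofReal hn2
    linarith
  -- … but `≥ δ − K'|tn − tinf| > δ/2`
  have h1 := hK a (tn (σ n)) (htn _) tinf htinf
  have h2 := hlow (σ n)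
  have h3 : K * |tn (σ n) - tinf| ≤ K' * |tn (σ n) - tinf| :=
    mul_le_mul_of_nonneg_right ((le_abs_self K).trans (by rw [hK']; linarith)) (abs_nonneg _)
  have h4 : K' * |tn (σ n) - tinf| < δ / 2 := by
    have := mul_lt_mul_of_pos_left hn1 hK'0
    rwa [mul_div_assoc', mul_comm K' δ, mul_div_mul_right _ _ hK'0.ne'] at this  -- K' * (δ/(2K')) = δ/2
  have h5 := abs_sub_abs_le_abs_sub (∫ x, φ (x + a) * ‖u (tn (σ n)) x‖ ^ 2)
    (∫ x, φ (x + a) * ‖u tinf x‖ ^ 2)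
  rw [← ha] at h2
  linarith [abs_nonneg (∫ x, φ (x + a) * ‖u tinf x‖ ^ 2),
    le_abs_self (∫ x, φ (x + a) * ‖u (tn (σ n)) x‖ ^ 2),
    le_abs_self ((∫ x, φ (x + a) * ‖u (tn (σ n)) x‖ ^ 2) - ∫ x, φ (x + a) * ‖u tinf x‖ ^ 2)]

end LocalEnergy

end Summit.NavierStokesRegularity.FluidComputer.PalasekTowerClayBridge

end
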